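import Summits.QuantumAdvantage.QuantumAdvantage.Theorems.FanInRootCollapseB
import Summits.QuantumAdvantage.QuantumAdvantage.Theorems.FanInRootCertificate

/-!
# FanInRoot (7/11): COMB SELECTION by double counting and the UNCONDITIONAL `Θ(√n)` fan-in rung `noPerfectFanInAll_root`
-/

set_option linter.dupNamespace false -- D-0017: single-problem summit ⇒ `QuantumAdvantage.QuantumAdvantage` by design

namespace Summit.QuantumAdvantage.QuantumAdvantage.Theorems.FanInRoot

open Finset
open Summit.QuantumAdvantage.AdviceFreeQNC0
open Literature.Computability.QuantumComplexity
open Literature.Computability.QuantumComplexity.RingHLF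
open Literature.Computability.MetaComplexity
open scoped Classical

/-! ### §6f COMB SELECTION (double counting, no greedy): an UNCONDITIONAL `Θ(√n)` fan-in rung

A non-wrapping arithmetic COMB `{t, t+g, …, t+(k−1)g}` with `g` odd and `k ≡ n (mod 2)` is an even-stretch hub set.  Against reading sets of size `≤ f`,
a comb is bad only if some `S_j` contains two of its teeth; the map (bad comb) ↦ (j, a, b, tooth_a, tooth_b) is injective, so `#bad ≤ 36·n·f²`, while there are
`≥ (n/2)·(n/20)` combs (`t < n/2`, `g ≤ n/10` odd).  For `f ≤ √n/64` a good comb exists. -/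
namespace Comb

/-- `5` hubs on odd rings, `6` on even rings (so that `n − k` is even). -/
def kOf (n : ℕ) : ℕ := if n % 2 = 1 then 5 else 6

/-- FanInRoot helper `kOf_cases` (lens-1 g6 FanInRoot package; see the module docstring). -/
theorem kOf_cases (n : ℕ) : (kOf n = 5 ∧ n % 2 = 1) ∨ (kOf n = 6 ∧ n % 2 = 0) := by
  unfold kOf; by_cases h : n % 2 = 1
  · exact Or.inl ⟨by rw [if_pos h], h⟩
  · exact Or.inr ⟨by rw [if_neg h], by omega⟩

/-- The comb as a hub set (membership form — no `Fin` arithmetic in the definition). -/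
def comb (n t g k : ℕ) : Finset (Fin n) := univ.filter fun i : Fin n => ∃ a, a < k ∧ i.val = t + a * g

/-- FanInRoot helper `mem_comb` (lens-1 g6 FanInRoot package; see the module docstring). -/
theorem mem_comb {n t g k : ℕ} {i : Fin n} : i ∈ comb n t g k ↔ ∃ a, a < k ∧ i.val = t + a * g := by
  simp [comb]

/-- The `a`-th tooth. -/
def tooth (n t g k : ℕ) (h : t + (k - 1) * g < n) (a : Fin k) : Fin n :=
  ⟨t + a.val * g, by
    have ha : a.val ≤ k - 1 := by have := a.isLt; omega
    have := Nat.mul_le_mul_right g ha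
    omega⟩

/-- FanInRoot helper `tooth_injective` (lens-1 g6 FanInRoot package; see the module docstring). -/
theorem tooth_injective {n t g k : ℕ} (h : t + (k - 1) * g < n) (hg : 0 < g) : Function.Injective (tooth n t g k h) := by
  intro a b hab
  simp only [tooth, Fin.mk.injEq] at hab
  exact Fin.ext (Nat.eq_of_mul_eq_mul_right hg (by omega))

/-- FanInRoot helper `comb_eq_image` (lens-1 g6 FanInRoot package; see the module docstring). -/
theorem comb_eq_image {n t g k : ℕ} (h : t + (k - 1) * g < n) : comb n t g k = univ.image (tooth n t g k h) := by
  ext i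
  simp only [mem_comb, mem_image, mem_univ, true_and]
  constructor
  · rintro ⟨a, ha, hi⟩; exact ⟨⟨a, ha⟩, Fin.ext (by simp [tooth, hi])⟩
  · rintro ⟨a, rfl⟩; exact ⟨a.val, a.isLt, rfl⟩

/-- FanInRoot helper `card_comb` (lens-1 g6 FanInRoot package; see the module docstring). -/
theorem card_comb {n t g k : ℕ} (h : t + (k - 1) * g < n) (hg : 0 < g) : (comb n t g k).card = k := by
  rw [comb_eq_image h, card_image_of_injective _ (tooth_injective h hg), card_univ, Fintype.card_fin]

/-- FanInRoot helper `card_comb_filter_lt` (lens-1 g6 FanInRoot package; see the module docstring). -/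
theorem card_comb_filter_lt {n t g k : ℕ} (h : t + (k - 1) * g < n) (hg : 0 < g) (a' : Fin k) :
    ((comb n t g k).filter fun i => i < tooth n t g k h a').card = a'.val := by
  rw [comb_eq_image h, Finset.filter_image, card_image_of_injective _ (tooth_injective h hg)]
  have : (univ.filter fun a : Fin k => tooth n t g k h a < tooth n t g k h a') = Finset.Iio a' := by
    ext a
    simp only [mem_filter, mem_univ, true_and, Finset.mem_Iio, tooth, Fin.lt_def]
    constructor
    · intro hlt; by_contra hle; push Not at hle
      have := Nat.mul_le_mul_right g hle; omega
    · intro hlt; have := Nat.mul_lt_mul_of_pos_right hlt hg; omega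
  rw [this, Fin.card_Iio]

/-- FanInRoot helper `mul_odd_mod_two` (lens-1 g6 FanInRoot package; see the module docstring). -/
theorem mul_odd_mod_two (a g : ℕ) (hg : g % 2 = 1) : (a * g) % 2 = a % 2 := by
  rw [Nat.mul_mod, hg, mul_one, Nat.mod_mod]

/-- A non-wrapping comb with odd spacing and `k ≡ n (mod 2)` teeth is an even-stretch configuration. -/
theorem evenStretch_comb {n t g k : ℕ} (h : t + (k - 1) * g < n) (hg : 0 < g) (hodd : g % 2 = 1) (hkn : (n - k) % 2 = 0) :
    comb n t g k ∈ EvenStretch n := by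
  refine ⟨by rw [card_comb h hg]; exact hkn, ?_⟩
  intro i hi i' hi'
  rw [comb_eq_image h] at hi hi'
  simp only [mem_image, mem_univ, true_and] at hi hi'
  obtain ⟨a, rfl⟩ := hi
  obtain ⟨a', rfl⟩ := hi'
  rw [card_comb_filter_lt h hg a', card_comb_filter_lt h hg a]
  simp only [tooth]
  have h1 := mul_odd_mod_two a.val g hodd
  have h2 := mul_odd_mod_two a'.val g hodd
  omega

/-- Teeth are separated: two comb members inside one reading set are what "bad" means. -/
def Good {n : ℕ} (S : Fin n → Finset (Fin n)) (k : ℕ) : Set (ℕ × ℕ) := {p |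
  ∀ j, ∀ i ∈ S j, ∀ i' ∈ S j, i ∈ comb n p.1 p.2 k → i' ∈ comb n p.1 p.2 k → i = i' }

/-- FanInRoot helper `sqrt_div_sq_le` (lens-1 g6 FanInRoot package; see the module docstring). -/
theorem sqrt_div_sq_le (n : ℕ) : 4096 * (Nat.sqrt n / 64) ^ 2 ≤ n := by
  have h1 : 64 * (Nat.sqrt n / 64) ≤ Nat.sqrt n := Nat.mul_div_le (Nat.sqrt n) 64
  have h2 : Nat.sqrt n * Nat.sqrt n ≤ n := Nat.sqrt_le n
  calc 4096 * (Nat.sqrt n / 64) ^ 2 = (64 * (Nat.sqrt n / 64)) * (64 * (Nat.sqrt n / 64)) := by ring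
    _ ≤ Nat.sqrt n * Nat.sqrt n := Nat.mul_le_mul h1 h1
    _ ≤ n := h2

/-- **COMB SELECTION THEOREM.**  For `n ≥ 4096`, against reading sets of size `≤ √n/64` there is a GOOD non-wrapping comb with odd spacing and `kOf n` teeth. -/
theorem comb_select (n : ℕ) (hn : 4096 ≤ n) (S : Fin n → Finset (Fin n)) (hS : ∀ j, (S j).card ≤ Nat.sqrt n / 64) :
    ∃ t g : ℕ, 0 < g ∧ g % 2 = 1 ∧ t + (kOf n - 1) * g < n ∧ (t, g) ∈ Good S (kOf n) := by
  set k := kOf n with hkdef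
  set f := Nat.sqrt n / 64 with hfdef
  have hk : k = 5 ∨ k = 6 := by rcases kOf_cases n with ⟨h, -⟩ | ⟨h, -⟩ <;> simp [hkdef, h]
  have hk1 : 1 ≤ k := by omega
  have hk6 : k ≤ 6 := by omega
  -- the comb family: t < n/2, g odd ≤ n/10
  let T : Finset ℕ := Finset.range (n / 2)
  let G : Finset ℕ := (Finset.range (n / 10 + 1)).filter fun g => g % 2 = 1
  let D : Finset (ℕ × ℕ) := T ×ˢ G
  have hD_ok : ∀ p ∈ D, 0 < p.2 ∧ p.2 % 2 = 1 ∧ p.1 + (k - 1) * p.2 < n := by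
    intro p hp
    simp only [D, T, G, mem_product, mem_range, mem_filter] at hp
    obtain ⟨ht, hg, hodd⟩ := hp
    refine ⟨by omega, hodd, ?_⟩
    have : (k - 1) * p.2 ≤ 5 * (n / 10) := Nat.mul_le_mul (by omega) (by omega)
    omega
  by_contra hnone
  push Not at hnone
  have hbad : ∀ p ∈ D, ∃ w : Fin n × Fin 6 × Fin 6 × Fin n × Fin n,
      w.2.2.2.1 ∈ S w.1 ∧ w.2.2.2.2 ∈ S w.1 ∧ w.2.1.val < w.2.2.1.val ∧
      w.2.2.2.1.val = p.1 + w.2.1.val * p.2 ∧ w.2.2.2.2.val = p.1 + w.2.2.1.val * p.2 := by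
    intro p hp
    obtain ⟨hg0, hodd, hlt⟩ := hD_ok p hp
    have hng := hnone p.1 p.2 hg0 hodd hlt
    simp only [Good, Set.mem_setOf_eq, not_forall, exists_prop] at hng
    obtain ⟨j, i, hi, i', hi', hic, hic', hne⟩ := hng
    obtain ⟨a, ha, hia⟩ := mem_comb.1 hic
    obtain ⟨b, hb, hib⟩ := mem_comb.1 hic'
    have hab : a ≠ b := by rintro rfl; exact hne (Fin.ext (by omega))
    rcases Nat.lt_or_gt_of_ne hab with hab | hab
    · exact ⟨(j, ⟨a, by omega⟩, ⟨b, by omega⟩, i, i'), hi, hi', hab, hia, hib⟩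
    · exact ⟨(j, ⟨b, by omega⟩, ⟨a, by omega⟩, i', i), hi', hi, hab, hib, hia⟩
  haveI : Nonempty (Fin n × Fin 6 × Fin 6 × Fin n × Fin n) := ⟨(⟨0, by omega⟩, 0, 0, ⟨0, by omega⟩, ⟨0, by omega⟩)⟩
  choose! Ψ hΨ using hbad
  -- the witness set
  let W : Finset (Fin n × Fin 6 × Fin 6 × Fin n × Fin n) :=
    (univ : Finset (Fin n × Fin 6 × Fin 6)).biUnion fun jab =>
      ((S jab.1) ×ˢ (S jab.1)).image fun ii => (jab.1, jab.2.1, jab.2.2, ii.1, ii.2)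
  have hmaps : ∀ p ∈ D, Ψ p ∈ W := by
    intro p hp
    obtain ⟨h1, h2, -, -, -⟩ := hΨ p hp
    rw [Finset.mem_biUnion]
    refine ⟨((Ψ p).1, (Ψ p).2.1, (Ψ p).2.2.1), mem_univ _, ?_⟩
    rw [Finset.mem_image]
    exact ⟨((Ψ p).2.2.2.1, (Ψ p).2.2.2.2), Finset.mem_product.2 ⟨h1, h2⟩, rfl⟩
  have hinj : Set.InjOn Ψ D := by
    intro p hp p' hp' heq
    obtain ⟨-, -, hab, hia, hib⟩ := hΨ p hp
    obtain ⟨-, -, hab', hia', hib'⟩ := hΨ p' hp'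
    rw [heq] at hia hib
    -- same (a, b, i, i') for both combs
    have hg : (((Ψ p').2.2.1.val - (Ψ p').2.1.val) * p.2) = (((Ψ p').2.2.1.val - (Ψ p').2.1.val) * p'.2) := by
      have e1 : (Ψ p').2.2.2.2.val - (Ψ p').2.2.2.1.val = ((Ψ p').2.2.1.val - (Ψ p').2.1.val) * p.2 := by
        rw [hib, hia, Nat.sub_mul]; omega
      have e2 : (Ψ p').2.2.2.2.val - (Ψ p').2.2.2.1.val = ((Ψ p').2.2.1.val - (Ψ p').2.1.val) * p'.2 := by
        rw [hib', hia', Nat.sub_mul]; omega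
      rw [← e1, ← e2]
    have hg' : p.2 = p'.2 := Nat.eq_of_mul_eq_mul_left (by omega) hg
    have ht : p.1 = p'.1 := by
      have := hia.symm.trans hia'
      rw [hg'] at this; omega
    exact Prod.ext ht hg'
  have hcard : D.card ≤ W.card := Finset.card_le_card_of_injOn Ψ hmaps hinj
  -- |W| ≤ 36 n f²
  have hW : W.card ≤ n * 36 * f ^ 2 := by
    calc W.card ≤ ∑ jab : Fin n × Fin 6 × Fin 6, (((S jab.1) ×ˢ (S jab.1)).image fun ii => (jab.1, jab.2.1, jab.2.2, ii.1, ii.2)).card :=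
          Finset.card_biUnion_le
      _ ≤ ∑ jab : Fin n × Fin 6 × Fin 6, f ^ 2 := Finset.sum_le_sum fun jab _ => by
          refine le_trans Finset.card_image_le ?_
          rw [Finset.card_product, sq]
          exact Nat.mul_le_mul (hS _) (hS _)
      _ = n * 36 * f ^ 2 := by rw [Finset.sum_const, Finset.card_univ, smul_eq_mul, Fintype.card_prod, Fintype.card_prod, Fintype.card_fin, Fintype.card_fin]
  -- |D| = (n/2)·|G| with |G| ≥ (n/10)/2
  have hDcard : D.card = (n / 2) * G.card := by simp [D, T, Finset.card_product]
  have hG : (n / 10) / 2 ≤ G.card := by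
    have : (Finset.range ((n / 10) / 2)).card ≤ G.card := by
      refine Finset.card_le_card_of_injOn (fun i => 2 * i + 1) (fun i hi => ?_) (fun i _ i' _ h => by simp only at h; omega)
      simp only [G, mem_range, mem_filter, Finset.mem_coe] at hi ⊢
      omega
    simpa using this
  have hf : 4096 * f ^ 2 ≤ n := sqrt_div_sq_le n
  have hlt : n * 36 * f ^ 2 < D.card := by
    rw [hDcard]
    have h1 : n ≤ 2 * (n / 2) + 1 := by omega
    have h2 : n ≤ 20 * G.card + 39 := by omega
    nlinarith
  omega

end Comb

/-! ### The even-stretch TABLE LAW `r = 1` and the `Θ(√n)` FAN-IN RUNG -/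

/-- **EVEN-STRETCH TABLE LAW, `r = 1`:** every even-stretch configuration of 5 or 6 hubs defeats single-hub readers. -/
theorem hubLoses_one {n : ℕ} (H : Finset (Fin n)) (hE : H ∈ EvenStretch n) (h56 : H.card = 5 ∨ H.card = 6) : H ∈ HubLoses n 1 := by
  refine hubLoses_of_hubLosesDeg (collapseLaw3 n 1 H hE (by omega) ?_)
  rcases h56 with h | h
  · rw [h]; exact smallRingLosesDeg_5_1
  · rw [h]; exact smallRingLosesDeg_6_1

/-- **THEOREM (UNCONDITIONAL, DEGREE-FREE).**  On `C_n`, `n ≥ 4096`, NO strategy all of whose outputs read at most `√n/64` inputs is perfect on the odd class. -/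
theorem noPerfectFanInAll_root : (fun n => Nat.sqrt n / 64) ∈ NoPerfectFanInAll := by
  refine ⟨4096, fun n hn z hz => ?_⟩
  choose S hS using hz
  obtain ⟨t, g, hg0, hodd, hlt, hgood⟩ := Comb.comb_select n hn S fun j => (hS j).1
  have hkn : (n - Comb.kOf n) % 2 = 0 := by
    rcases Comb.kOf_cases n with ⟨hk, hn2⟩ | ⟨hk, hn2⟩ <;> rw [hk] <;> omega
  have hE : Comb.comb n t g (Comb.kOf n) ∈ EvenStretch n := Comb.evenStretch_comb hlt hg0 hodd hkn
  have h56 : (Comb.comb n t g (Comb.kOf n)).card = 5 ∨ (Comb.comb n t g (Comb.kOf n)).card = 6 := by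
    rw [Comb.card_comb hlt hg0]
    rcases Comb.kOf_cases n with ⟨hk, -⟩ | ⟨hk, -⟩
    · exact Or.inl hk
    · exact Or.inr hk
  have hmeet : ∀ j, (S j ∩ Comb.comb n t g (Comb.kOf n)).card ≤ 1 := fun j =>
    Finset.card_le_one.2 fun i hi i' hi' =>
      hgood j i (Finset.mem_inter.1 hi).1 i' (Finset.mem_inter.1 hi').1 (Finset.mem_inter.1 hi).2 (Finset.mem_inter.1 hi').2
  obtain ⟨x, -, hox, hrel⟩ := hubLoses_one _ hE h56 z fun j =>
    ⟨S j ∩ Comb.comb n t g (Comb.kOf n), Finset.inter_subset_right, hmeet j,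
      fun x x' hx hx' hR => dep_on_hubs (hS j).2 x x' hx hx' hR⟩
  exact ⟨x, hox, hrel⟩

/-- **RUNG R1′:** no perfect constant-degree strategy with all fan-ins `≤ √n/64`. -/
theorem noPerfectFanInRoot3 : (fun n => Nat.sqrt n / 64) ∈ NoPerfectFanIn3 := noPerfectFanIn3_of_all noPerfectFanInAll_root

end Summit.QuantumAdvantage.QuantumAdvantage.Theorems.FanInRoot
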